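import Mathlib
import Literature.MathematicalPhysics.QuantumLattice.GrassmannGaussianQuadraticInsertion
import Literature.MathematicalPhysics.QuantumLattice.GrassmannTwoPointEffectiveAction

/-!
# A quadratic insertion and the TWO-LEG kernel of the effective action: the dressed chain plus the dressed two-leg kernel
# of the renormalised-covariance action

Topic `Literature/MathematicalPhysics/QuantumLattice`; sequel of `GrassmannGaussianQuadraticInsertion.lean` (expectation level:
`∫ dμ_C e^{q} F = (∫ dμ_C e^{q}) · ∫ dμ_{C'} F`, `C' = M C`, `M (1 + C S) = 1`, `S = N − Nᵀ`, for the quadratic insertion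
`q = Σ N(X,Y) ψ(X)ψ(Y)` and an antisymmetric covariance `C`; that file flags «not here: the convolution-level form») and of
`GrassmannTwoPointEffectiveAction.lean` (the two-point function from the quadratic kernel of the effective action).  Here the
convolution-level statement is obtained AT THE TWO-LEG KERNEL, which is what the renormalisation-group files consume: writing
`D_W(X,Y) := constPart (∂_X ∂_Y W)` for the quadratic coefficient of an even `W` and `A'(X,Y) = ½(C'(Y,X) − C'(X,Y))` for the pair
function of `C' = M C`, for every even interaction `V` without constant part (unit partition functions)

  `D_{effAction C (V − q)}(X,Y) = D_{W'}(X,Y) + Σ_{Z,U} S(X,Z) A'(Z,U) D_{W'}(U,Y) − Σ_{Z,U} S(Y,Z) A'(Z,U) D_{W'}(U,X)`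
  `   − Σ_{Z,Z₂,U,U₂} S(X,Z) S(Y,Z₂) A'(Z,U) A'(Z₂,U₂) D_{W'}(U₂,U) − S(Y,X) − Σ_{Z,Z₂} S(X,Z) S(Y,Z₂) A'(Z,Z₂)`,  `W' = effAction C' V`

(`constPart_deriv_deriv_effAction_sub_quadratic`): in matrix form `D_{W_tot} = (1 + S A') D_{W'} (1 + S A')ᵀ − Sᵀ − S A' Sᵀ` — the
quadratic part of the Wilsonian effective action of `V − q` with covariance `C` is the «chain» of the quadratic vertex through `C`
(the last two terms, `= K(1 − C K)⁻¹`-type) plus the quadratic part of the effective action of the PURELY non-quadratic `V` with the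
RENORMALISED covariance `C' = (1 + C S)⁻¹ C`, dressed on both legs by `T = 1 + A' S` («the counterterm is treated as an extra
interaction vertex» versus «`E = e + K` in the propagator», Feldman–Salmhofer–Trubowitz 1996 §1; Benfatto–Giuliani–Mastropietro 2006
(2.21)–(2.24) and §2.9 (2.90)–(2.92)).  Proof: `Z·e^{−W} = μ_C ⋆ e^{−(V−q)} = μ_C ⋆ (e^{q} e^{−V})`; two field derivatives commute with
`μ_C ⋆` (`grassmannDeriv_gaussConv`) and act on `e^{q} e^{−V}` by the Leibniz rule with `∂_Y e^{q} = e^{q}·Σ_Z S(Y,Z)ψ(Z)`; the factor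
`e^{q}` renormalises the covariance (`gaussExpect_grassmannExp_mul_of_transpose_eq_neg`); the remaining `C'`-expectations of
`∂∂e^{−V}`, `ψ ∂e^{−V}`, `ψψ e^{−V}` are quadratic kernels of `W'` by Wick's rule (`gaussExpect_gen_mul`,
`gaussExpect_gen_mul_gen_mul_grassmannExp_neg`).  No inverse of `C` is used (singular cutoff covariances allowed).
Corollary in `kernel` form (`kernel_two_effAction_sub_quadratic`).  Everything is proved; no definitions, no named facts.

## Sources

J. Feldman, M. Salmhofer, E. Trubowitz, J. Stat. Phys. 84 (1996) 1209–1336, §1 [`FeldmanSalmhoferTrubowitz1996`];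
G. Benfatto, A. Giuliani, V. Mastropietro, Ann. Henri Poincaré 7 (2006) 809–898, (2.21)–(2.24), §2.9 (2.90)–(2.92)
[`BenfattoGiulianiMastropietro2006`]; M. Salmhofer, *Renormalization* (1999), §4.3 (4.86)–(4.91) [`Salmhofer1999`].  [folklore]
-/

noncomputable section

namespace Literature.MathematicalPhysics.QuantumLattice

open GrassmannAlgebra Finset

variable {𝕜 : Type*} [RCLike 𝕜] {Γ : Type*} [Fintype Γ] [DecidableEq Γ]

/-! ### A linear form in the generators past a derivative -/

/-- `∂_X (Σ_Z v(Z)ψ(Z) · a) = v(X)·a − (Σ_Z v(Z)ψ(Z)) · ∂_X a` (graded Leibniz rule on a degree-one left factor, Berezin 1966 Ch. I §3).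
[cite: Berezin1966, Ch. I §3] -/
theorem grassmannDeriv_sum_smul_gen_mul (X : Γ) (v : Γ → 𝕜) (a : GrassmannAlgebra 𝕜 Γ) :
    grassmannDeriv 𝕜 X ((∑ Z, v Z • gen 𝕜 Z) * a) = v X • a - (∑ Z, v Z • gen 𝕜 Z) * grassmannDeriv 𝕜 X a := by
  rw [Finset.sum_mul, map_sum, Finset.sum_mul]
  have h : ∀ Z, grassmannDeriv 𝕜 X (v Z • gen 𝕜 Z * a) =
      (if X = Z then v Z • a else 0) - v Z • (gen 𝕜 Z * grassmannDeriv 𝕜 X a) := by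
    intro Z
    rw [smul_mul_assoc, map_smul, grassmannDeriv_gen_mul, smul_sub]
    split_ifs <;> simp
  simp_rw [h, Finset.sum_sub_distrib, Finset.sum_ite_eq, Finset.mem_univ, if_true, smul_mul_assoc]

/-- **Two derivatives of `e^{q}·G`** for a quadratic `q = Σ N(X,Y)ψ(X)ψ(Y)`: with `S = N − Nᵀ` and `s_Y := ∂_Y q = Σ_Z S(Y,Z)ψ(Z)`,
`∂_X ∂_Y (e^{q} G) = e^{q}·(s_X s_Y G + s_X ∂_Y G + (S(Y,X)·G − s_Y ∂_X G) + ∂_X ∂_Y G)` (the Leibniz rule of Salmhofer's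
`e^{Δ}`-calculus, Salmhofer 1999 §4.3.1 (4.86)–(4.90), applied twice to the even factor `e^{q}`). [cite: Salmhofer1999, §4.3.1 (4.86)–(4.90)] -/
theorem grassmannDeriv_grassmannDeriv_grassmannExp_quadratic_mul (N : Matrix Γ Γ 𝕜) {q : GrassmannAlgebra 𝕜 Γ}
    (hq : q = ∑ X, ∑ Y, N X Y • (gen 𝕜 X * gen 𝕜 Y)) {S : Matrix Γ Γ 𝕜} (hS : S = Matrix.of fun X Y => N X Y - N Y X)
    (X Y : Γ) (G : GrassmannAlgebra 𝕜 Γ) :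
    grassmannDeriv 𝕜 X (grassmannDeriv 𝕜 Y (grassmannExp q * G)) =
      grassmannExp q *
        ((∑ Z, S X Z • gen 𝕜 Z) * ((∑ Z, S Y Z • gen 𝕜 Z) * G) + (∑ Z, S X Z • gen 𝕜 Z) * grassmannDeriv 𝕜 Y G +
          (S Y X • G - (∑ Z, S Y Z • gen 𝕜 Z) * grassmannDeriv 𝕜 X G) + grassmannDeriv 𝕜 X (grassmannDeriv 𝕜 Y G)) := by
  have hqe : q ∈ evenOdd 𝕜 0 := quadratic_mem_evenOdd_zero_of_eq N hq
  have hqn : IsNilpotent q := isNilpotent_of_eq_quadratic N hq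
  have hexp : grassmannExp q ∈ evenOdd 𝕜 0 := grassmannExp_mem_evenOdd_zero 𝕜 hqe hqn
  have hs : ∀ W : Γ, grassmannDeriv 𝕜 W (grassmannExp q) = grassmannExp q * ∑ Z, S W Z • gen 𝕜 Z := by
    intro W
    rw [grassmannDeriv_grassmannExp_of_eq_quadratic N hq W]
    congr 1
    refine Finset.sum_congr rfl fun Z _ => ?_
    rw [hS, Matrix.of_apply]
  rw [grassmannDeriv_mul_of_mem_evenOdd_zero 𝕜 Y hexp, hs Y, map_add, mul_assoc,
    grassmannDeriv_mul_of_mem_evenOdd_zero 𝕜 X hexp, grassmannDeriv_mul_of_mem_evenOdd_zero 𝕜 X hexp, hs X,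
    grassmannDeriv_sum_smul_gen_mul X (fun Z => S Y Z) G]
  simp only [mul_assoc, mul_add]
  abel

section TwoLeg

variable (N : Matrix Γ Γ 𝕜) {q : GrassmannAlgebra 𝕜 Γ} (hq : q = ∑ X, ∑ Y, N X Y • (gen 𝕜 X * gen 𝕜 Y))
variable {C S M : Matrix Γ Γ 𝕜} (hC : C.transpose = -C) (hS : S = Matrix.of fun X Y => N X Y - N Y X)
  (hM : M * (1 + C * S) = 1)
variable {V : GrassmannAlgebra 𝕜 Γ} (hV : V ∈ evenPart 𝕜 Γ) (hV0 : constPart 𝕜 V = 0)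
  (hZ' : IsUnit (effPartitionFn 𝕜 (M * C) V)) (hZq : IsUnit (gaussExpect 𝕜 C (grassmannExp q)))

include hq hC hS hM hV hV0 hZ' hZq

/-- **The two-leg kernel of the effective action with a quadratic insertion** (explicit-sum form).  With `C' = M C`,
`A'(X,Y) = ½(C'(Y,X) − C'(X,Y))`, `W' = effAction C' V`, `D'(U,U') = constPart(∂_U ∂_{U'} W')`:
`constPart(∂_X ∂_Y effAction C (V − q)) = D'(X,Y) + Σ S(X,Z)A'(Z,U)D'(U,Y) − Σ S(Y,Z)A'(Z,U)D'(U,X)`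
`− Σ S(X,Z)S(Y,Z₂)A'(Z,U)A'(Z₂,U₂)D'(U₂,U) − S(Y,X) − Σ S(X,Z)S(Y,Z₂)A'(Z,Z₂)` — the dressed chain of the quadratic vertex plus the
dressed two-leg kernel of the renormalised-covariance action. [cite: BenfattoGiulianiMastropietro2006, (2.21)–(2.24) and §2.9 (2.90)–(2.92)] -/
theorem constPart_deriv_deriv_effAction_sub_quadratic (X Y : Γ) :
    constPart 𝕜 (grassmannDeriv 𝕜 X (grassmannDeriv 𝕜 Y (effAction 𝕜 C (V - q)))) =
      constPart 𝕜 (grassmannDeriv 𝕜 X (grassmannDeriv 𝕜 Y (effAction 𝕜 (M * C) V))) +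
        (∑ Z, ∑ U, S X Z * (((1 / 2 : ℚ) • (1 : 𝕜)) * ((M * C) U Z - (M * C) Z U)) *
            constPart 𝕜 (grassmannDeriv 𝕜 U (grassmannDeriv 𝕜 Y (effAction 𝕜 (M * C) V)))) -
        (∑ Z, ∑ U, S Y Z * (((1 / 2 : ℚ) • (1 : 𝕜)) * ((M * C) U Z - (M * C) Z U)) *
            constPart 𝕜 (grassmannDeriv 𝕜 U (grassmannDeriv 𝕜 X (effAction 𝕜 (M * C) V)))) -
        (∑ Z, ∑ Z₂, ∑ U, ∑ U₂, S X Z * S Y Z₂ * (((1 / 2 : ℚ) • (1 : 𝕜)) * ((M * C) U Z - (M * C) Z U)) *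
            (((1 / 2 : ℚ) • (1 : 𝕜)) * ((M * C) U₂ Z₂ - (M * C) Z₂ U₂)) *
              constPart 𝕜 (grassmannDeriv 𝕜 U₂ (grassmannDeriv 𝕜 U (effAction 𝕜 (M * C) V)))) -
        S Y X - ∑ Z, ∑ Z₂, S X Z * S Y Z₂ * (((1 / 2 : ℚ) • (1 : 𝕜)) * ((M * C) Z₂ Z - (M * C) Z Z₂)) := by
  -- parity / nilpotency bookkeeping
  have hqe : q ∈ evenOdd 𝕜 0 := quadratic_mem_evenOdd_zero_of_eq N hq
  have hqn : IsNilpotent q := isNilpotent_of_eq_quadratic N hq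
  have hVe : V ∈ evenOdd 𝕜 0 := (mem_evenPart_iff).1 hV
  have hVn : IsNilpotent (-V) := isNilpotent_of_constPart_eq_zero 𝕜 (by rw [map_neg, hV0, neg_zero])
  have hVq : V - q ∈ evenPart 𝕜 Γ := (mem_evenPart_iff).2 (Submodule.sub_mem _ hVe hqe)
  have hVq0 : constPart 𝕜 (V - q) = 0 := by rw [map_sub, hV0, constPart_eq_zero_of_eq_quadratic N hq, sub_zero]
  have hW'e : effAction 𝕜 (M * C) V ∈ evenPart 𝕜 Γ := effAction_mem_evenPart (M * C) hV hV0
  have hW'0 : constPart 𝕜 (effAction 𝕜 (M * C) V) = 0 := constPart_effAction 𝕜 (M * C) V hZ'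
  -- the total partition function factorises, hence is a unit
  have hZtot : effPartitionFn 𝕜 C (V - q) = gaussExpect 𝕜 C (grassmannExp q) * effPartitionFn 𝕜 (M * C) V :=
    effPartitionFn_sub_of_transpose_eq_neg N hq hC hS hM hV0
  have hZtotU : IsUnit (effPartitionFn 𝕜 C (V - q)) := by rw [hZtot]; exact hZq.mul hZ'
  have hWe : effAction 𝕜 C (V - q) ∈ evenPart 𝕜 Γ := effAction_mem_evenPart C hVq hVq0
  have hW0 : constPart 𝕜 (effAction 𝕜 C (V - q)) = 0 := constPart_effAction 𝕜 C (V - q) hZtotU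
  -- `e^{-(V - q)} = e^{q} e^{-V}`
  have hexpsplit : grassmannExp (-(V - q)) = grassmannExp q * grassmannExp (-V) := by
    rw [neg_sub, sub_eq_add_neg, grassmannExp, IsNilpotent.exp_add_of_commute (commute_of_eq_quadratic N hq (-V)) hqn hVn]
    rfl
  -- (a) the second derivative of the effective Boltzmann factor at zero, via `Z e^{-W}`
  have hlhs : constPart 𝕜 (grassmannDeriv 𝕜 X (grassmannDeriv 𝕜 Y (effBoltzmann 𝕜 C (V - q)))) =
      -(effPartitionFn 𝕜 C (V - q) * constPart 𝕜 (grassmannDeriv 𝕜 X (grassmannDeriv 𝕜 Y (effAction 𝕜 C (V - q))))) := by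
    rw [effBoltzmann_eq_smul_grassmannExp 𝕜 C (V - q) hZtotU, map_smul, map_smul, map_smul, smul_eq_mul,
      constPart_grassmannDeriv_grassmannDeriv_grassmannExp_neg X Y hWe hW0, mul_neg]
  -- (b) the same, via `μ_C ⋆ (e^{q} e^{-V})` and the renormalised covariance
  have hrhs : constPart 𝕜 (grassmannDeriv 𝕜 X (grassmannDeriv 𝕜 Y (effBoltzmann 𝕜 C (V - q)))) =
      gaussExpect 𝕜 C (grassmannExp q) * gaussExpect 𝕜 (M * C)
        ((∑ Z, S X Z • gen 𝕜 Z) * ((∑ Z, S Y Z • gen 𝕜 Z) * grassmannExp (-V)) +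
          (∑ Z, S X Z • gen 𝕜 Z) * grassmannDeriv 𝕜 Y (grassmannExp (-V)) +
          (S Y X • grassmannExp (-V) - (∑ Z, S Y Z • gen 𝕜 Z) * grassmannDeriv 𝕜 X (grassmannExp (-V))) +
          grassmannDeriv 𝕜 X (grassmannDeriv 𝕜 Y (grassmannExp (-V)))) := by
    rw [effBoltzmann_def, grassmannDeriv_gaussConv, grassmannDeriv_gaussConv, ← gaussExpect_apply, hexpsplit,
      grassmannDeriv_grassmannDeriv_grassmannExp_quadratic_mul N hq hS X Y (grassmannExp (-V)),
      gaussExpect_grassmannExp_mul_of_transpose_eq_neg N hq hC hS hM]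
  -- the four `C'`-expectations
  -- (1) second derivatives of `e^{-V}`
  have hsecond : ∀ a b : Γ, gaussExpect 𝕜 (M * C) (grassmannDeriv 𝕜 a (grassmannDeriv 𝕜 b (grassmannExp (-V)))) =
      -(effPartitionFn 𝕜 (M * C) V * constPart 𝕜 (grassmannDeriv 𝕜 a (grassmannDeriv 𝕜 b (effAction 𝕜 (M * C) V)))) := by
    intro a b
    rw [gaussExpect_apply, ← grassmannDeriv_gaussConv, ← grassmannDeriv_gaussConv, ← effBoltzmann_def,
      effBoltzmann_eq_smul_grassmannExp 𝕜 (M * C) V hZ', map_smul, map_smul, map_smul, smul_eq_mul,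
      constPart_grassmannDeriv_grassmannDeriv_grassmannExp_neg a b hW'e hW'0, mul_neg]
  -- (2) one field times a first derivative (Wick's rule once)
  have hfirst : ∀ (v : Γ → 𝕜) (b : Γ),
      gaussExpect 𝕜 (M * C) ((∑ Z, v Z • gen 𝕜 Z) * grassmannDeriv 𝕜 b (grassmannExp (-V))) =
        -(effPartitionFn 𝕜 (M * C) V * ∑ Z, ∑ U, v Z * (((1 / 2 : ℚ) • (1 : 𝕜)) * ((M * C) U Z - (M * C) Z U)) *
          constPart 𝕜 (grassmannDeriv 𝕜 U (grassmannDeriv 𝕜 b (effAction 𝕜 (M * C) V)))) := by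
    intro v b
    rw [Finset.sum_mul, map_sum, Finset.mul_sum, ← Finset.sum_neg_distrib]
    refine Finset.sum_congr rfl fun Z _ => ?_
    rw [smul_mul_assoc, map_smul, gaussExpect_gen_mul, smul_eq_mul, Finset.mul_sum, Finset.mul_sum, ← Finset.sum_neg_distrib]
    refine Finset.sum_congr rfl fun U _ => ?_
    rw [hsecond U b]
    ring
  -- (3) two fields (the landed two-point formula)
  have htwo : ∀ (v w : Γ → 𝕜),
      gaussExpect 𝕜 (M * C) ((∑ Z, v Z • gen 𝕜 Z) * ((∑ Z, w Z • gen 𝕜 Z) * grassmannExp (-V))) =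
        effPartitionFn 𝕜 (M * C) V *
          (∑ Z, ∑ Z₂, v Z * w Z₂ * (((1 / 2 : ℚ) • (1 : 𝕜)) * ((M * C) Z₂ Z - (M * C) Z Z₂)) +
            ∑ Z, ∑ Z₂, ∑ U, ∑ U₂, v Z * w Z₂ * (((1 / 2 : ℚ) • (1 : 𝕜)) * ((M * C) U Z - (M * C) Z U)) *
              (((1 / 2 : ℚ) • (1 : 𝕜)) * ((M * C) U₂ Z₂ - (M * C) Z₂ U₂)) *
                constPart 𝕜 (grassmannDeriv 𝕜 U₂ (grassmannDeriv 𝕜 U (effAction 𝕜 (M * C) V)))) := by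
    intro v w
    have h1 : (∑ Z, v Z • gen 𝕜 Z) * ((∑ Z, w Z • gen 𝕜 Z) * grassmannExp (-V)) =
        ∑ Z, ∑ Z₂, (v Z * w Z₂) • (gen 𝕜 Z * gen 𝕜 Z₂ * grassmannExp (-V)) := by
      rw [Finset.sum_mul]
      refine Finset.sum_congr rfl fun Z _ => ?_
      rw [Finset.sum_mul, Finset.mul_sum]
      refine Finset.sum_congr rfl fun Z₂ _ => ?_
      rw [smul_mul_assoc, smul_mul_assoc, mul_smul_comm, smul_smul, ← mul_assoc]
    rw [h1, map_sum, mul_add, Finset.mul_sum, Finset.mul_sum, ← Finset.sum_add_distrib]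
    refine Finset.sum_congr rfl fun Z _ => ?_
    rw [map_sum, Finset.mul_sum, Finset.mul_sum, ← Finset.sum_add_distrib]
    refine Finset.sum_congr rfl fun Z₂ _ => ?_
    rw [map_smul, smul_eq_mul, gaussExpect_gen_mul_gen_mul_grassmannExp_neg (M * C) hV hV0 hZ' Z Z₂]
    simp only [Finset.mul_sum, mul_add]
    congr 1
    · ring
    · refine Finset.sum_congr rfl fun U _ => Finset.sum_congr rfl fun U₂ _ => ?_
      ring
  -- (4) zeroth order
  have hzero : gaussExpect 𝕜 (M * C) (S Y X • grassmannExp (-V)) = S Y X * effPartitionFn 𝕜 (M * C) V := by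
    rw [LinearMap.map_smul, smul_eq_mul, effPartitionFn_eq_gaussExpect]
  -- assemble: both computations of the same number
  have key := hlhs.symm.trans hrhs
  rw [hZtot, map_add, map_add, map_add, map_sub, htwo, hfirst, hzero, hfirst, hsecond] at key
  -- cancel the unit `Zq * Z'`
  have hu : IsUnit (gaussExpect 𝕜 C (grassmannExp q) * effPartitionFn 𝕜 (M * C) V) := hZq.mul hZ'
  refine hu.mul_left_cancel ?_
  linear_combination (-1 : 𝕜) * key

/-- **Kernel form**: with `kernel F 2 (a,b) = ½·constPart(∂_b ∂_a F)`, the two-leg kernel of `effAction C (V − q)` at `(a,b)` is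
half the same combination read at `X = b`, `Y = a`. [cite: BenfattoGiulianiMastropietro2006, (2.21)–(2.24) and §2.9 (2.90)–(2.92)] -/
theorem kernel_two_effAction_sub_quadratic (a b : Γ) :
    kernel 𝕜 (effAction 𝕜 C (V - q)) 2 ![a, b] =
      (((2 : ℕ).factorial : ℚ)⁻¹ • (1 : 𝕜)) *
        (constPart 𝕜 (grassmannDeriv 𝕜 b (grassmannDeriv 𝕜 a (effAction 𝕜 (M * C) V))) +
          (∑ Z, ∑ U, S b Z * (((1 / 2 : ℚ) • (1 : 𝕜)) * ((M * C) U Z - (M * C) Z U)) *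
              constPart 𝕜 (grassmannDeriv 𝕜 U (grassmannDeriv 𝕜 a (effAction 𝕜 (M * C) V)))) -
          (∑ Z, ∑ U, S a Z * (((1 / 2 : ℚ) • (1 : 𝕜)) * ((M * C) U Z - (M * C) Z U)) *
              constPart 𝕜 (grassmannDeriv 𝕜 U (grassmannDeriv 𝕜 b (effAction 𝕜 (M * C) V)))) -
          (∑ Z, ∑ Z₂, ∑ U, ∑ U₂, S b Z * S a Z₂ * (((1 / 2 : ℚ) • (1 : 𝕜)) * ((M * C) U Z - (M * C) Z U)) *
              (((1 / 2 : ℚ) • (1 : 𝕜)) * ((M * C) U₂ Z₂ - (M * C) Z₂ U₂)) *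
                constPart 𝕜 (grassmannDeriv 𝕜 U₂ (grassmannDeriv 𝕜 U (effAction 𝕜 (M * C) V)))) -
          S a b - ∑ Z, ∑ Z₂, S b Z * S a Z₂ * (((1 / 2 : ℚ) • (1 : 𝕜)) * ((M * C) Z₂ Z - (M * C) Z Z₂))) := by
  rw [kernel_def]
  congr 1
  have hiter : iterDeriv 𝕜 (![a, b] : Fin 2 → Γ) = grassmannDeriv 𝕜 b * grassmannDeriv 𝕜 a := by
    simp [iterDeriv, List.ofFn_succ]
  rw [hiter, Module.End.mul_apply]
  exact constPart_deriv_deriv_effAction_sub_quadratic N hq hC hS hM hV hV0 hZ' hZq b a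

end TwoLeg

end Literature.MathematicalPhysics.QuantumLattice

end
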